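import Summits.Ventures.LatticeQCDFlow.Scoring.NonabelianAreaLaw2DOpenWilsonLoop
import Summits.Ventures.LatticeQCDFlow.Scoring.OnePlaquetteHaarMGF
import Summits.Ventures.LatticeQCDFlow.Scoring.SUNOnePlaquetteHaarMGF
import Summits.Ventures.LatticeQCDFlow.Scoring.UNFluxSectors
import Summits.Ventures.LatticeQCDFlow.Scoring.UNOnePlaquettePlaquetteRange
import Summits.Ventures.LatticeQCDFlow.Scoring.SUNOnePlaquettePlaquetteRange
import HarnessLib

/-!
# The exact non-abelian area law in two dimensions, VI: CLOSED FORMS — the `U(N)` and `SU(N)` Wilson loops as `(N⁻¹ (log Z_N)′(β))^{RT}` and the `U(N)` flux loops `⟨Re det(W)^q⟩ = (det[I_{|i−j+q|}]/det[I_{|i−j|}])^{RT}`, every `N`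

HONEST FRAMING: exact (Metropolis-corrected) sampling algorithms for lattice gauge theory;
figures of merit are autocorrelation/cost numbers at stated couplings and volumes; no
continuum-physics claim.

Venture `LatticeQCDFlow` (cell pub-lqcd), sub-topic `Scoring`; FANOUT row 5 (`s0-sun-a`), GEN-18.
NEW WORK of the cell (placement rule).  Part III (`NonabelianAreaLaw2DOpenWilsonLoop`) proves, with free boundary
on the plaquettes enclosed by the loop, `⟨W_{R×T}⟩_{open, β} = P_N(β)^{RT}` for `U(N)` and `SU(N)` (`P_N` the one-plaquette
plaquette) and, for any observable representation with scalar one-plaquette matrix and any class weight,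
`⟨W⟩ = Re((c/∫w)^{RT})` (`openWilsonLoop_eq_re_pow_of_scalar`).  GEN-17 evaluated the one-plaquette integrals on the
Haar measure for every `N`: `P_N = N⁻¹ (log det[I_{|i−j|}])′` for `U(N)` (`OnePlaquetteHaarMGF`),
`P_N = N⁻¹ (log Σ_q det[I_{|q+i−j|}])′` for `SU(N)` (`SUNOnePlaquetteHaarMGF`), and
`∫_{U(N)} (det u)^q e^{x Re tr u} du = det[I_{|i−j+q|}(x)]` (`UNFluxSectors`).  Together, for every `N ≥ 1`, every real
`β`, every corner and every `R × T` loop with `R + 1 ≤ L`, `T + 1 ≤ L`: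

* §1 **`unitary_openWilsonLoop_eq_deriv_log_det_pow`** — `⟨W_{R×T}⟩_{open, β}^{U(N)} = (N⁻¹ (log det[I_{|i−j|}])′(β))^{RT}`,
  and `unitary_openWilsonLoop_monotone` (the `RT`-th power of a quantity non-decreasing in `β`);
  `unitary_openWilsonLoop_pos_log_eq` — for `β > 0` the loop is positive and `log ⟨W_{R×T}⟩ = RT · log P_N(β)`
  EXACTLY (GEN-17 `UNOnePlaquettePlaquetteRange.unitary_plaquette_pos`): effective string tension `−log P_N(β)` from any
  single loop, every Creutz ratio `= −log P_N(β)`;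
* §2 **`specialUnitary_openWilsonLoop_eq_deriv_log_tsum_det_pow`** — `⟨W_{R×T}⟩_{open, β}^{SU(N)} =
  (N⁻¹ (log Σ_q det[I_{|q+i−j|}])′(β))^{RT}`, `specialUnitary_openWilsonLoop_monotone`, and for `N ≥ 2`, `β > 0`
  `specialUnitary_openWilsonLoop_pos_log_eq` (`log ⟨W_{R×T}⟩ = RT · log P_N(β)`; GEN-17 `SUNOnePlaquettePlaquetteRange`);
* §3 `exists_continuous_detZPow_rep` (a continuous `σ_q : U(N) →* M_1(ℂ)` with `σ_q(u) = (det u)^q`, built inside the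
  proof — no definition is added), `wilsonLoop_detZPow_eq` (`wilsonLoop σ_q = Re (det W)^q`, the FLUX LOOP), and
  **`unitary_fluxLoop_eq_det_ratio_pow`** — for every `q ∈ ℤ` and every continuous realisation `σ` of `(det)^q`:
  `⟨Re det(W_{R×T})^q⟩_{open, β}^{U(N)} = (det[I_{|a−b+q|}(β)] / det[I_{|a−b|}(β)])^{RT}`.

No `def`, nothing cited as a fact, 0 sorry.
-/

noncomputable section

open MeasureTheory Function Finset
open Literature.MathematicalPhysics.QuantumFieldTheory
open Literature.MathematicalPhysics.QuantumLattice
open Literature.Analysis.FunctionSpaces (besselI)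
open Summit.Ventures.LatticeQCDFlow.Theory2.Lattice
open Summit.Ventures.LatticeQCDFlow.Theory2.Lattice.TwoDim

namespace Summit.Ventures.LatticeQCDFlow.Scoring

variable {L : ℕ} [NeZero L]

/-! ## §1. `U(N)` -/

/-- **THE WILSON LOOP OF TWO-DIMENSIONAL `U(N)` LATTICE YANG–MILLS IN CLOSED FORM, EVERY `N ≥ 1`, EVERY REAL `β`**:
with free boundary conditions on the `R × T` block of plaquettes enclosed by the loop,
`⟨W_{R×T}⟩_{open, β} = (N⁻¹ · (d/dβ) log det[I_{|i−j|}(β)]_{N×N})^{RT}`. -/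
theorem unitary_openWilsonLoop_eq_deriv_log_det_pow (N : ℕ) [NeZero N] (β : ℝ) (i j : ZMod L) {R T : ℕ}
    (hR : R + 1 ≤ L) (hT : T + 1 ≤ L) :
    (∫ U, wilsonLoop (unitaryFundamentalRep (Fin N) ℂ) ![i, j] 0 1 R T U *
          ∏ p ∈ (range R ×ˢ range T).image (fun q : ℕ × ℕ => (![i + q.1, j + q.2] : Site 2 L)),
            Real.exp (-(β * ((N : ℝ) - ((plaquetteHolonomy U p 0 1 : Matrix.unitaryGroup (Fin N) ℂ) :
              Matrix (Fin N) (Fin N) ℂ).trace.re)))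
          ∂(Measure.pi fun _ : Edge 2 L => haarProbability (Matrix.unitaryGroup (Fin N) ℂ))) /
        ∫ U, ∏ p ∈ (range R ×ˢ range T).image (fun q : ℕ × ℕ => (![i + q.1, j + q.2] : Site 2 L)),
            Real.exp (-(β * ((N : ℝ) - ((plaquetteHolonomy U p 0 1 : Matrix.unitaryGroup (Fin N) ℂ) :
              Matrix (Fin N) (Fin N) ℂ).trace.re)))
          ∂(Measure.pi fun _ : Edge 2 L => haarProbability (Matrix.unitaryGroup (Fin N) ℂ)) =
      (1 / N * deriv (fun x : ℝ =>
        Real.log (Matrix.of fun a b : Fin N => besselI ((a : ℤ) - (b : ℤ)).natAbs x).det) β) ^ (R * T) := by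
  rw [unitary_openWilsonLoop_eq_plaquette_pow N β i j hR hT, unitary_plaquette_eq_deriv_log_det]

/-- At fixed area `RT` the free-boundary `U(N)` Wilson loop is the `RT`-th power of the one-plaquette plaquette,
which is non-decreasing in `β` (`monotone_unitary_plaquette`): for `β ≤ β'`,
`⟨W_{R×T}⟩_{open, β} = P_N(β)^{RT}` and `⟨W_{R×T}⟩_{open, β'} = P_N(β')^{RT}` with `P_N(β) ≤ P_N(β')`. -/
theorem unitary_openWilsonLoop_monotone (N : ℕ) [NeZero N] {β β' : ℝ} (hββ' : β ≤ β') (i j : ZMod L) {R T : ℕ}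
    (hR : R + 1 ≤ L) (hT : T + 1 ≤ L) :
    ∃ P P' : ℝ, P ≤ P' ∧
      (∫ U, wilsonLoop (unitaryFundamentalRep (Fin N) ℂ) ![i, j] 0 1 R T U *
          ∏ p ∈ (range R ×ˢ range T).image (fun q : ℕ × ℕ => (![i + q.1, j + q.2] : Site 2 L)),
            Real.exp (-(β * ((N : ℝ) - ((plaquetteHolonomy U p 0 1 : Matrix.unitaryGroup (Fin N) ℂ) :
              Matrix (Fin N) (Fin N) ℂ).trace.re)))
          ∂(Measure.pi fun _ : Edge 2 L => haarProbability (Matrix.unitaryGroup (Fin N) ℂ))) /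
        ∫ U, ∏ p ∈ (range R ×ˢ range T).image (fun q : ℕ × ℕ => (![i + q.1, j + q.2] : Site 2 L)),
            Real.exp (-(β * ((N : ℝ) - ((plaquetteHolonomy U p 0 1 : Matrix.unitaryGroup (Fin N) ℂ) :
              Matrix (Fin N) (Fin N) ℂ).trace.re)))
          ∂(Measure.pi fun _ : Edge 2 L => haarProbability (Matrix.unitaryGroup (Fin N) ℂ)) = P ^ (R * T) ∧
      (∫ U, wilsonLoop (unitaryFundamentalRep (Fin N) ℂ) ![i, j] 0 1 R T U *
          ∏ p ∈ (range R ×ˢ range T).image (fun q : ℕ × ℕ => (![i + q.1, j + q.2] : Site 2 L)),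
            Real.exp (-(β' * ((N : ℝ) - ((plaquetteHolonomy U p 0 1 : Matrix.unitaryGroup (Fin N) ℂ) :
              Matrix (Fin N) (Fin N) ℂ).trace.re)))
          ∂(Measure.pi fun _ : Edge 2 L => haarProbability (Matrix.unitaryGroup (Fin N) ℂ))) /
        ∫ U, ∏ p ∈ (range R ×ˢ range T).image (fun q : ℕ × ℕ => (![i + q.1, j + q.2] : Site 2 L)),
            Real.exp (-(β' * ((N : ℝ) - ((plaquetteHolonomy U p 0 1 : Matrix.unitaryGroup (Fin N) ℂ) :
              Matrix (Fin N) (Fin N) ℂ).trace.re)))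
          ∂(Measure.pi fun _ : Edge 2 L => haarProbability (Matrix.unitaryGroup (Fin N) ℂ)) = P' ^ (R * T) := by
  refine ⟨_, _, monotone_unitary_plaquette N hββ', unitary_openWilsonLoop_eq_plaquette_pow N β i j hR hT,
    unitary_openWilsonLoop_eq_plaquette_pow N β' i j hR hT⟩

/-- **POSITIVE COUPLING: THE `U(N)` LOOP IS POSITIVE AND ITS LOGARITHM IS EXACTLY LINEAR IN THE AREA** — for
`β > 0` (GEN-17 `unitary_plaquette_pos`: `P_N(β) > 0`), every `N ≥ 1` and every `R × T` loop:
`⟨W_{R×T}⟩_{open, β} > 0` and `log ⟨W_{R×T}⟩_{open, β} = RT · log P_N(β)`: the effective string tension read off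
ANY single loop is `−log P_N(β)`, with no perimeter or corner term (so every Creutz ratio equals `−log P_N(β)`). -/
theorem unitary_openWilsonLoop_pos_log_eq (N : ℕ) [NeZero N] {β : ℝ} (hβ : 0 < β) (i j : ZMod L) {R T : ℕ}
    (hR : R + 1 ≤ L) (hT : T + 1 ≤ L) :
    0 < (∫ U, wilsonLoop (unitaryFundamentalRep (Fin N) ℂ) ![i, j] 0 1 R T U *
          ∏ p ∈ (range R ×ˢ range T).image (fun q : ℕ × ℕ => (![i + q.1, j + q.2] : Site 2 L)),
            Real.exp (-(β * ((N : ℝ) - ((plaquetteHolonomy U p 0 1 : Matrix.unitaryGroup (Fin N) ℂ) :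
              Matrix (Fin N) (Fin N) ℂ).trace.re)))
          ∂(Measure.pi fun _ : Edge 2 L => haarProbability (Matrix.unitaryGroup (Fin N) ℂ))) /
        ∫ U, ∏ p ∈ (range R ×ˢ range T).image (fun q : ℕ × ℕ => (![i + q.1, j + q.2] : Site 2 L)),
            Real.exp (-(β * ((N : ℝ) - ((plaquetteHolonomy U p 0 1 : Matrix.unitaryGroup (Fin N) ℂ) :
              Matrix (Fin N) (Fin N) ℂ).trace.re)))
          ∂(Measure.pi fun _ : Edge 2 L => haarProbability (Matrix.unitaryGroup (Fin N) ℂ)) ∧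
    Real.log ((∫ U, wilsonLoop (unitaryFundamentalRep (Fin N) ℂ) ![i, j] 0 1 R T U *
          ∏ p ∈ (range R ×ˢ range T).image (fun q : ℕ × ℕ => (![i + q.1, j + q.2] : Site 2 L)),
            Real.exp (-(β * ((N : ℝ) - ((plaquetteHolonomy U p 0 1 : Matrix.unitaryGroup (Fin N) ℂ) :
              Matrix (Fin N) (Fin N) ℂ).trace.re)))
          ∂(Measure.pi fun _ : Edge 2 L => haarProbability (Matrix.unitaryGroup (Fin N) ℂ))) /
        ∫ U, ∏ p ∈ (range R ×ˢ range T).image (fun q : ℕ × ℕ => (![i + q.1, j + q.2] : Site 2 L)),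
            Real.exp (-(β * ((N : ℝ) - ((plaquetteHolonomy U p 0 1 : Matrix.unitaryGroup (Fin N) ℂ) :
              Matrix (Fin N) (Fin N) ℂ).trace.re)))
          ∂(Measure.pi fun _ : Edge 2 L => haarProbability (Matrix.unitaryGroup (Fin N) ℂ))) =
      (R * T : ℕ) * Real.log ((∫ u, ((u : Matrix.unitaryGroup (Fin N) ℂ) : Matrix (Fin N) (Fin N) ℂ).trace.re / N *
            Real.exp (-(β * ((N : ℝ) - ((u : Matrix.unitaryGroup (Fin N) ℂ) : Matrix (Fin N) (Fin N) ℂ).trace.re)))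
          ∂(haarProbability (Matrix.unitaryGroup (Fin N) ℂ))) /
        (∫ u, Real.exp (-(β * ((N : ℝ) - ((u : Matrix.unitaryGroup (Fin N) ℂ) : Matrix (Fin N) (Fin N) ℂ).trace.re)))
          ∂(haarProbability (Matrix.unitaryGroup (Fin N) ℂ)))) := by
  rw [unitary_openWilsonLoop_eq_plaquette_pow N β i j hR hT]
  exact ⟨pow_pos (unitary_plaquette_pos N hβ) _, Real.log_pow _ _⟩

/-! ## §2. `SU(N)` -/

/-- **THE WILSON LOOP OF TWO-DIMENSIONAL `SU(N)` LATTICE YANG–MILLS IN CLOSED FORM, EVERY `N ≥ 1`, EVERY REAL `β`**: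
with free boundary conditions on the `R × T` block of plaquettes enclosed by the loop,
`⟨W_{R×T}⟩_{open, β} = (N⁻¹ · (d/dβ) log Σ_{q∈ℤ} det[I_{|q+i−j|}(β)]_{N×N})^{RT}`. -/
theorem specialUnitary_openWilsonLoop_eq_deriv_log_tsum_det_pow (N : ℕ) [NeZero N] (β : ℝ) (i j : ZMod L)
    {R T : ℕ} (hR : R + 1 ≤ L) (hT : T + 1 ≤ L) :
    (∫ U, wilsonLoop (fundamentalRep (Fin N)) ![i, j] 0 1 R T U *
          ∏ p ∈ (range R ×ˢ range T).image (fun q : ℕ × ℕ => (![i + q.1, j + q.2] : Site 2 L)),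
            Real.exp (-(β * ((N : ℝ) - ((plaquetteHolonomy U p 0 1 : Matrix.specialUnitaryGroup (Fin N) ℂ) :
              Matrix (Fin N) (Fin N) ℂ).trace.re)))
          ∂(Measure.pi fun _ : Edge 2 L => haarProbability (Matrix.specialUnitaryGroup (Fin N) ℂ))) /
        ∫ U, ∏ p ∈ (range R ×ˢ range T).image (fun q : ℕ × ℕ => (![i + q.1, j + q.2] : Site 2 L)),
            Real.exp (-(β * ((N : ℝ) - ((plaquetteHolonomy U p 0 1 : Matrix.specialUnitaryGroup (Fin N) ℂ) :
              Matrix (Fin N) (Fin N) ℂ).trace.re)))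
          ∂(Measure.pi fun _ : Edge 2 L => haarProbability (Matrix.specialUnitaryGroup (Fin N) ℂ)) =
      (1 / N * deriv (fun x : ℝ =>
        Real.log (∑' q : ℤ, (Matrix.of fun a b : Fin N => besselI (q + (a : ℤ) - (b : ℤ)).natAbs x).det)) β) ^
          (R * T) := by
  rw [specialUnitary_openWilsonLoop_eq_plaquette_pow N β i j hR hT, specialUnitary_plaquette_eq_deriv_log_tsum_det]

/-- At fixed area the free-boundary `SU(N)` Wilson loop is the `RT`-th power of the one-plaquette plaquette, which
is non-decreasing in `β` (`monotone_specialUnitary_plaquette`). -/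
theorem specialUnitary_openWilsonLoop_monotone (N : ℕ) [NeZero N] {β β' : ℝ} (hββ' : β ≤ β') (i j : ZMod L)
    {R T : ℕ} (hR : R + 1 ≤ L) (hT : T + 1 ≤ L) :
    ∃ P P' : ℝ, P ≤ P' ∧
      (∫ U, wilsonLoop (fundamentalRep (Fin N)) ![i, j] 0 1 R T U *
          ∏ p ∈ (range R ×ˢ range T).image (fun q : ℕ × ℕ => (![i + q.1, j + q.2] : Site 2 L)),
            Real.exp (-(β * ((N : ℝ) - ((plaquetteHolonomy U p 0 1 : Matrix.specialUnitaryGroup (Fin N) ℂ) :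
              Matrix (Fin N) (Fin N) ℂ).trace.re)))
          ∂(Measure.pi fun _ : Edge 2 L => haarProbability (Matrix.specialUnitaryGroup (Fin N) ℂ))) /
        ∫ U, ∏ p ∈ (range R ×ˢ range T).image (fun q : ℕ × ℕ => (![i + q.1, j + q.2] : Site 2 L)),
            Real.exp (-(β * ((N : ℝ) - ((plaquetteHolonomy U p 0 1 : Matrix.specialUnitaryGroup (Fin N) ℂ) :
              Matrix (Fin N) (Fin N) ℂ).trace.re)))
          ∂(Measure.pi fun _ : Edge 2 L => haarProbability (Matrix.specialUnitaryGroup (Fin N) ℂ)) = P ^ (R * T) ∧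
      (∫ U, wilsonLoop (fundamentalRep (Fin N)) ![i, j] 0 1 R T U *
          ∏ p ∈ (range R ×ˢ range T).image (fun q : ℕ × ℕ => (![i + q.1, j + q.2] : Site 2 L)),
            Real.exp (-(β' * ((N : ℝ) - ((plaquetteHolonomy U p 0 1 : Matrix.specialUnitaryGroup (Fin N) ℂ) :
              Matrix (Fin N) (Fin N) ℂ).trace.re)))
          ∂(Measure.pi fun _ : Edge 2 L => haarProbability (Matrix.specialUnitaryGroup (Fin N) ℂ))) /
        ∫ U, ∏ p ∈ (range R ×ˢ range T).image (fun q : ℕ × ℕ => (![i + q.1, j + q.2] : Site 2 L)),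
            Real.exp (-(β' * ((N : ℝ) - ((plaquetteHolonomy U p 0 1 : Matrix.specialUnitaryGroup (Fin N) ℂ) :
              Matrix (Fin N) (Fin N) ℂ).trace.re)))
          ∂(Measure.pi fun _ : Edge 2 L => haarProbability (Matrix.specialUnitaryGroup (Fin N) ℂ)) =
        P' ^ (R * T) :=
  ⟨_, _, monotone_specialUnitary_plaquette N hββ', specialUnitary_openWilsonLoop_eq_plaquette_pow N β i j hR hT,
    specialUnitary_openWilsonLoop_eq_plaquette_pow N β' i j hR hT⟩

/-- **POSITIVE COUPLING, `SU(N)`, `N ≥ 2`**: for `β > 0` (GEN-17 `specialUnitary_plaquette_pos`) the free-boundary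
`SU(N)` loop is positive and `log ⟨W_{R×T}⟩_{open, β} = RT · log P_N(β)` exactly (every Creutz ratio
`= −log P_N(β)`). -/
theorem specialUnitary_openWilsonLoop_pos_log_eq (N : ℕ) (hN : 2 ≤ N) {β : ℝ} (hβ : 0 < β) (i j : ZMod L)
    {R T : ℕ} (hR : R + 1 ≤ L) (hT : T + 1 ≤ L) :
    haveI : NeZero N := ⟨by omega⟩
    0 < (∫ U, wilsonLoop (fundamentalRep (Fin N)) ![i, j] 0 1 R T U *
          ∏ p ∈ (range R ×ˢ range T).image (fun q : ℕ × ℕ => (![i + q.1, j + q.2] : Site 2 L)),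
            Real.exp (-(β * ((N : ℝ) - ((plaquetteHolonomy U p 0 1 : Matrix.specialUnitaryGroup (Fin N) ℂ) :
              Matrix (Fin N) (Fin N) ℂ).trace.re)))
          ∂(Measure.pi fun _ : Edge 2 L => haarProbability (Matrix.specialUnitaryGroup (Fin N) ℂ))) /
        ∫ U, ∏ p ∈ (range R ×ˢ range T).image (fun q : ℕ × ℕ => (![i + q.1, j + q.2] : Site 2 L)),
            Real.exp (-(β * ((N : ℝ) - ((plaquetteHolonomy U p 0 1 : Matrix.specialUnitaryGroup (Fin N) ℂ) :
              Matrix (Fin N) (Fin N) ℂ).trace.re)))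
          ∂(Measure.pi fun _ : Edge 2 L => haarProbability (Matrix.specialUnitaryGroup (Fin N) ℂ)) ∧
    Real.log ((∫ U, wilsonLoop (fundamentalRep (Fin N)) ![i, j] 0 1 R T U *
          ∏ p ∈ (range R ×ˢ range T).image (fun q : ℕ × ℕ => (![i + q.1, j + q.2] : Site 2 L)),
            Real.exp (-(β * ((N : ℝ) - ((plaquetteHolonomy U p 0 1 : Matrix.specialUnitaryGroup (Fin N) ℂ) :
              Matrix (Fin N) (Fin N) ℂ).trace.re)))
          ∂(Measure.pi fun _ : Edge 2 L => haarProbability (Matrix.specialUnitaryGroup (Fin N) ℂ))) /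
        ∫ U, ∏ p ∈ (range R ×ˢ range T).image (fun q : ℕ × ℕ => (![i + q.1, j + q.2] : Site 2 L)),
            Real.exp (-(β * ((N : ℝ) - ((plaquetteHolonomy U p 0 1 : Matrix.specialUnitaryGroup (Fin N) ℂ) :
              Matrix (Fin N) (Fin N) ℂ).trace.re)))
          ∂(Measure.pi fun _ : Edge 2 L => haarProbability (Matrix.specialUnitaryGroup (Fin N) ℂ))) =
      (R * T : ℕ) * Real.log ((∫ u, ((u : Matrix.specialUnitaryGroup (Fin N) ℂ) :
            Matrix (Fin N) (Fin N) ℂ).trace.re / N *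
            Real.exp (-(β * ((N : ℝ) -
              ((u : Matrix.specialUnitaryGroup (Fin N) ℂ) : Matrix (Fin N) (Fin N) ℂ).trace.re)))
          ∂(haarProbability (Matrix.specialUnitaryGroup (Fin N) ℂ))) /
        (∫ u, Real.exp (-(β * ((N : ℝ) -
            ((u : Matrix.specialUnitaryGroup (Fin N) ℂ) : Matrix (Fin N) (Fin N) ℂ).trace.re)))
          ∂(haarProbability (Matrix.specialUnitaryGroup (Fin N) ℂ)))) := by
  haveI : NeZero N := ⟨by omega⟩
  rw [specialUnitary_openWilsonLoop_eq_plaquette_pow N β i j hR hT]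
  exact ⟨pow_pos (specialUnitary_plaquette_pos N hN hβ) _, Real.log_pow _ _⟩

/-! ## §3. The flux loops of `U(N)` -/

/-- **The flux characters exist**: for every `N` and `q ∈ ℤ` there is a continuous one-dimensional representation
`σ : U(N) →* M_1(ℂ)` with `σ(u)_{00} = (det u)^q`. -/
theorem exists_continuous_detZPow_rep (N : ℕ) (q : ℤ) :
    ∃ σ : Matrix.unitaryGroup (Fin N) ℂ →* Matrix (Fin 1) (Fin 1) ℂ, Continuous σ ∧
      ∀ u, σ u 0 0 = (((u : Matrix.unitaryGroup (Fin N) ℂ) : Matrix (Fin N) (Fin N) ℂ).det) ^ q := by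
  have hdet0 : ∀ u : Matrix.unitaryGroup (Fin N) ℂ,
      ((u : Matrix.unitaryGroup (Fin N) ℂ) : Matrix (Fin N) (Fin N) ℂ).det ≠ 0 := fun u =>
    (Matrix.UnitaryGroup.det_isUnit u).ne_zero
  refine ⟨{ toFun := fun u => Matrix.of fun _ _ : Fin 1 =>
              (((u : Matrix.unitaryGroup (Fin N) ℂ) : Matrix (Fin N) (Fin N) ℂ).det) ^ q,
            map_one' := ?_, map_mul' := ?_ }, ?_, fun u => rfl⟩
  · ext i j
    have hi : i = 0 := Subsingleton.elim _ _
    have hj : j = 0 := Subsingleton.elim _ _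
    subst hi hj
    simp
  · intro u v
    ext i j
    have hi : i = 0 := Subsingleton.elim _ _
    have hj : j = 0 := Subsingleton.elim _ _
    subst hi hj
    rw [Matrix.mul_apply, Fin.sum_univ_one, Matrix.of_apply, Matrix.of_apply, Matrix.of_apply,
      Submonoid.coe_mul, Matrix.det_mul, mul_zpow]
  · refine continuous_pi fun _ => continuous_pi fun _ => ?_
    exact (continuous_subtype_val.matrix_det).zpow₀ q fun u => Or.inl (hdet0 u)

omit [NeZero L] in
/-- The Wilson loop observable of a realisation `σ` of the character `(det)^q` is the FLUX LOOP
`U ↦ Re (det W_{R×T}(U))^q`. -/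
theorem wilsonLoop_detZPow_eq (N : ℕ) (q : ℤ) (σ : Matrix.unitaryGroup (Fin N) ℂ →* Matrix (Fin 1) (Fin 1) ℂ)
    (hσ : ∀ u, σ u 0 0 = (((u : Matrix.unitaryGroup (Fin N) ℂ) : Matrix (Fin N) (Fin N) ℂ).det) ^ q)
    (x : Site 2 L) (i j : Fin 2) (R T : ℕ) (U : GaugeConfig 2 L (Matrix.unitaryGroup (Fin N) ℂ)) :
    wilsonLoop σ x i j R T U =
      ((((rectangleHolonomy U x i j R T : Matrix.unitaryGroup (Fin N) ℂ) : Matrix (Fin N) (Fin N) ℂ).det) ^ q).re := by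
  unfold wilsonLoop
  rw [Matrix.trace_fin_one, hσ, Nat.cast_one, inv_one, one_mul]

/-- **THE FLUX LOOPS OF TWO-DIMENSIONAL `U(N)` LATTICE YANG–MILLS IN CLOSED FORM.**  For every `N ≥ 1`, `q ∈ ℤ`,
every continuous realisation `σ` of the character `(det u)^q`, every real `β`, every corner `(i, j)` and every
`R × T` loop with `R + 1 ≤ L`, `T + 1 ≤ L` (free boundary on the enclosed plaquettes):
`⟨wilsonLoop σ⟩ = ⟨Re det(W_{R×T})^q⟩_{open, β} = (det[I_{|a−b+q|}(β)]_{N×N} / det[I_{|a−b|}(β)]_{N×N})^{RT}`. -/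
theorem unitary_fluxLoop_eq_det_ratio_pow (N : ℕ) [NeZero N] (q : ℤ)
    (σ : Matrix.unitaryGroup (Fin N) ℂ →* Matrix (Fin 1) (Fin 1) ℂ) (hσc : Continuous σ)
    (hσ : ∀ u, σ u 0 0 = (((u : Matrix.unitaryGroup (Fin N) ℂ) : Matrix (Fin N) (Fin N) ℂ).det) ^ q)
    (β : ℝ) (i j : ZMod L) {R T : ℕ} (hR : R + 1 ≤ L) (hT : T + 1 ≤ L) :
    (∫ U, wilsonLoop σ ![i, j] 0 1 R T U *
          ∏ p ∈ (range R ×ˢ range T).image (fun c : ℕ × ℕ => (![i + c.1, j + c.2] : Site 2 L)),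
            Real.exp (-(β * ((N : ℝ) - ((plaquetteHolonomy U p 0 1 : Matrix.unitaryGroup (Fin N) ℂ) :
              Matrix (Fin N) (Fin N) ℂ).trace.re)))
          ∂(Measure.pi fun _ : Edge 2 L => haarProbability (Matrix.unitaryGroup (Fin N) ℂ))) /
        ∫ U, ∏ p ∈ (range R ×ˢ range T).image (fun c : ℕ × ℕ => (![i + c.1, j + c.2] : Site 2 L)),
            Real.exp (-(β * ((N : ℝ) - ((plaquetteHolonomy U p 0 1 : Matrix.unitaryGroup (Fin N) ℂ) :
              Matrix (Fin N) (Fin N) ℂ).trace.re)))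
          ∂(Measure.pi fun _ : Edge 2 L => haarProbability (Matrix.unitaryGroup (Fin N) ℂ)) =
      ((Matrix.of fun a b : Fin N => besselI ((a : ℤ) - (b : ℤ) + q).natAbs β).det /
        (Matrix.of fun a b : Fin N => besselI ((a : ℤ) - (b : ℤ)).natAbs β).det) ^ (R * T) := by
  have hw : Continuous fun u : Matrix.unitaryGroup (Fin N) ℂ =>
      Real.exp (-(β * ((N : ℝ) - ((u : Matrix.unitaryGroup (Fin N) ℂ) : Matrix (Fin N) (Fin N) ℂ).trace.re))) := by
    fun_prop
  -- the weight splits as `e^{−Nβ} e^{β Re tr}`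
  have hsplit : ∀ u : Matrix.unitaryGroup (Fin N) ℂ,
      Real.exp (-(β * ((N : ℝ) - ((u : Matrix.unitaryGroup (Fin N) ℂ) : Matrix (Fin N) (Fin N) ℂ).trace.re)))
        = Real.exp (-(N * β)) *
          Real.exp (β * ((u : Matrix.unitaryGroup (Fin N) ℂ) : Matrix (Fin N) (Fin N) ℂ).trace.re) := by
    intro u; rw [← Real.exp_add]; congr 1; ring
  -- the scalar `c = ∫ det^q · w = e^{−Nβ} det[I_{|a−b+q|}]`
  set c : ℂ := ∫ u, (((u : Matrix.unitaryGroup (Fin N) ℂ) : Matrix (Fin N) (Fin N) ℂ).det) ^ q *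
      (Real.exp (-(β * ((N : ℝ) -
        ((u : Matrix.unitaryGroup (Fin N) ℂ) : Matrix (Fin N) (Fin N) ℂ).trace.re))) : ℂ)
      ∂(haarProbability (Matrix.unitaryGroup (Fin N) ℂ)) with hc_def
  have hc : c = (Real.exp (-(N * β)) : ℂ) *
      ((Matrix.of fun a b : Fin N => besselI ((a : ℤ) - (b : ℤ) + q).natAbs β).det : ℂ) := by
    rw [hc_def, ← integral_haar_unitaryGroup_fin_det_zpow_mul_exp N β q, ← integral_const_mul]
    refine integral_congr_ae (ae_of_all _ fun u => ?_)
    beta_reduce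
    rw [hsplit, Complex.ofReal_mul]
    ring
  have hm : ∫ u, Real.exp (-(β * ((N : ℝ) -
      ((u : Matrix.unitaryGroup (Fin N) ℂ) : Matrix (Fin N) (Fin N) ℂ).trace.re)))
      ∂(haarProbability (Matrix.unitaryGroup (Fin N) ℂ)) =
      Real.exp (-(N * β)) * (Matrix.of fun a b : Fin N => besselI ((a : ℤ) - (b : ℤ)).natAbs β).det := by
    rw [← integral_haar_unitaryGroup_fin_exp_mul_trace_re N β, ← integral_const_mul]
    exact integral_congr_ae (ae_of_all _ fun u => by beta_reduce; exact hsplit u)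
  -- the one-plaquette matrix of the character is the 1 × 1 scalar `c`
  have hM : (Matrix.of fun k l : Fin 1 => ∫ u, σ u k l *
      (Real.exp (-(β * ((N : ℝ) -
        ((u : Matrix.unitaryGroup (Fin N) ℂ) : Matrix (Fin N) (Fin N) ℂ).trace.re))) : ℂ)
      ∂(haarProbability (Matrix.unitaryGroup (Fin N) ℂ))) = c • (1 : Matrix (Fin 1) (Fin 1) ℂ) := by
    ext k l
    have hk : k = 0 := Subsingleton.elim _ _
    have hl : l = 0 := Subsingleton.elim _ _
    subst hk hl
    rw [Matrix.of_apply, Matrix.smul_apply, Matrix.one_apply_eq, smul_eq_mul, mul_one, hc_def]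
    refine integral_congr_ae (ae_of_all _ fun u => ?_)
    beta_reduce
    rw [hσ]
  rw [openWilsonLoop_eq_re_pow_of_scalar σ hσc hw (unitary_wilsonWeight_conj N β) hM i j hR hT, hc, hm]
  have he : (Real.exp (-(N * β)) : ℝ) ≠ 0 := (Real.exp_pos _).ne'
  rw [show ((Real.exp (-(N * β)) : ℂ) *
      ((Matrix.of fun a b : Fin N => besselI ((a : ℤ) - (b : ℤ) + q).natAbs β).det : ℂ)) /
        ((Real.exp (-(N * β)) * (Matrix.of fun a b : Fin N => besselI ((a : ℤ) - (b : ℤ)).natAbs β).det : ℝ) : ℂ)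
      = (((Matrix.of fun a b : Fin N => besselI ((a : ℤ) - (b : ℤ) + q).natAbs β).det /
          (Matrix.of fun a b : Fin N => besselI ((a : ℤ) - (b : ℤ)).natAbs β).det : ℝ) : ℂ) by
    push_cast
    rw [mul_div_mul_left _ _ (by exact_mod_cast he)],
    ← Complex.ofReal_pow, Complex.ofReal_re]

end Summit.Ventures.LatticeQCDFlow.Scoring
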